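import Mathlib
import Summits.ResolutionOfSingularities.ResolutionOfSingularities.Theorems.WildQuotientsWildQuotientResolutionJordanThreeConeBlowup

/-!
# V3U-C4: the blow-up of the `A₁`-cone `× 𝔸ᵐ` at its vertex locus is regular (assembly)

(crux stmt-ResolutionOfSingularities-15640 `WildQuotients.WildQuotientResolution`, line `Sketch`,
sector `|G| = p`; programme V3U of `L/w45c/CHAIN.md` v5, candidate C4 `cone_affineBlowup_isRegular` of
`L/w45c/W45cPlanSignaturesV5.lean` §C, signature VERBATIM. [OURS · L1 W4.5c] — NOT a statement of any
manuscript; replaces the role of no printed item. Prover res-L1-w45c-stub-4.)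

`C = k[X_o : o ∈ Option (Fin n)]/(P R − Q²)`, `P = X (some a)`, `Q = X (some b)`, `R = X none`; the
blow-up of `Spec C` along `(P, Q, R)` is covered by `D₊(P t)` and `D₊(R t)` (both affine spaces,
`…JordanThreeConeBlowup`), since `(Q t)² = (P t)(R t)` in the Rees algebra puts `D₊(Q t)` inside
`D₊(P t)`; `JordanThree.isRegular_affineBlowup_of_charts` (p483495) concludes.
-/

-- single-problem summit: the doubled namespace component `ResolutionOfSingularities` is forced
set_option linter.dupNamespace false

noncomputable section

open MvPolynomial AlgebraicGeometry CategoryTheory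
open Literature.AlgebraicGeometry.Resolution

namespace Summit.ResolutionOfSingularities.ResolutionOfSingularities.Theorems.WildQuotientResolution.JordanThree

/-- **V3U-C4 `cone_affineBlowup_isRegular`** (`W45cPlanSignaturesV5.lean` §C, verbatim): the
blow-up of the `A₁`-cone `× 𝔸^{n−2}`, `k[X_o]/(X_{some a} X_{none} − X_{some b}²)`, along its vertex
locus `(X_{some a}, X_{some b}, X_{none})` is a regular scheme (charts `k[P, Q/P, …]`, `k[R, Q/R, …]`,
and `D₊(Q t) ⊆ D₊(P t)`). [OURS · L1 W4.5c] [folklore] -/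
theorem cone_affineBlowup_isRegular (k : Type) [Field k] (n : ℕ) (a b : Fin n) (hab : a ≠ b) :
    Scheme.IsRegular (affineBlowup
      (Ideal.map (Ideal.Quotient.mk (Ideal.span
          ({X (some a) * X none - X (some b) ^ 2} : Set (MvPolynomial (Option (Fin n)) k))))
        (Ideal.span {X (some a), X (some b), X none}))) := by
  classical
  let J : Ideal (MvPolynomial (Option (Fin n)) k) :=
    Ideal.span ({X (some a) * X none - X (some b) ^ 2} : Set (MvPolynomial (Option (Fin n)) k))
  let π : MvPolynomial (Option (Fin n)) k →+* MvPolynomial (Option (Fin n)) k ⧸ J :=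
    Ideal.Quotient.mk J
  let c : Fin 3 → MvPolynomial (Option (Fin n)) k ⧸ J := ![π (X (some a)), π (X (some b)), π (X none)]
  have hI : Ideal.map π (Ideal.span {X (some a), X (some b), X none}) = Ideal.span (Set.range c) := by
    rw [Ideal.map_span]
    congr 1
    ext x
    simp only [Set.mem_image, Set.mem_insert_iff, Set.mem_singleton_iff, Set.mem_range]
    constructor
    · rintro ⟨y, hy, rfl⟩
      rcases hy with rfl | rfl | rfl
      exacts [⟨0, rfl⟩, ⟨1, rfl⟩, ⟨2, rfl⟩]
    · rintro ⟨j, rfl⟩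
      fin_cases j
      exacts [⟨_, Or.inl rfl, rfl⟩, ⟨_, Or.inr (Or.inl rfl), rfl⟩, ⟨_, Or.inr (Or.inr rfl), rfl⟩]
  change Scheme.IsRegular (affineBlowup (Ideal.map π (Ideal.span {X (some a), X (some b), X none})))
  rw [hI]
  have h0 := isRegularRing_chartRing_cone_P k n a b hab
  have h2 := isRegularRing_chartRing_cone_R k n a b hab
  have hsq : reesT (c 1) (Ideal.mem_span_range_self (f := c) (x := 1)) ^ 2 =
      reesT (c 0) (Ideal.mem_span_range_self (f := c) (x := 0)) *
        reesT (c 2) (Ideal.mem_span_range_self (f := c) (x := 2)) := by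
    apply Subtype.ext
    simp only [Subalgebra.coe_pow, Subalgebra.coe_mul, coe_reesT, Polynomial.monomial_pow,
      Polynomial.monomial_mul_monomial]
    change Polynomial.monomial (1 * 2) (c 1 ^ 2) = Polynomial.monomial (1 + 1) (c 0 * c 2)
    congr 1
    exact (cone_rel k n a b).symm
  refine isRegular_affineBlowup_of_charts c fun i => ?_
  fin_cases i
  · exact ⟨0, h0, le_rfl⟩
  · refine ⟨0, h0, ?_⟩
    change Proj.basicOpen _ (reesT (c 1) (Ideal.mem_span_range_self (f := c) (x := 1))) ≤
      Proj.basicOpen _ (reesT (c 0) (Ideal.mem_span_range_self (f := c) (x := 0)))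
    rw [← Proj.basicOpen_pow _ _ 2 two_pos, hsq, Proj.basicOpen_mul]
    exact inf_le_left
  · exact ⟨2, h2, le_rfl⟩

end Summit.ResolutionOfSingularities.ResolutionOfSingularities.Theorems.WildQuotientResolution.JordanThree

end
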